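import Literature.NumberTheory.EllipticCurves.PAdicLFunctionTameDepletionCongruenceAtTwoProofs
import Literature.NumberTheory.EllipticCurves.PAdicLFunctionIntegralityAtTwoAutoProofs
import HarnessLib

/-!
# The tame `2`-adic congruences WITHOUT the `E[2]`-irreducibility hypothesis ("INT2-AUTO at tame level"):
# `‖μ_{f,α,m}‖₂ ≤ 2`, `L₂(f,α,χ) ∈ Λ`, `L₂(f,α,χ) ≡ L₂(f,α,𝟙_m) ≡ u·L₂(f,α)·∏𝒫_ℓ (mod 2Λ)` for EVERY `E` good ordinary at `2`
# (Matsuno 2000, Lemmas 3.2–3.3 at `p = 2`; PROOFS ONLY)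

A *proofs* file (theorems only: no definition, no named fact, no axiom). The tree's
`PAdicLFunctionTameIntegralityAtTwoProofs` / `PAdicLFunctionTameDepletionCongruenceAtTwoProofs` prove the `2`-integrality of the
tame Mazur–Swinnerton-Dyer transforms `L₂(f, α, χ, T)` and Matsuno's congruences `L₂(f,α,χ) ≡ L₂(f,α,𝟙_m) ≡ u·L₂(f,α)·∏_{ℓ∣m}𝒫_ℓ
(mod 2Λ)` for `E = W/ℚ` good ordinary at `2` UNDER `ρ̄_{E,2}` irreducible — the irreducibility entering ONLY through an odd
Eisenstein multiple `n₀{∞,0}_f ∈ Λ_f` that bounds `‖μ_{f,α,m}‖₂ ≤ 2` (`norm_msdMeasureTame_two_le_two`). That hypothesis is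
SUPERFLUOUS, exactly as at level one (`PAdicLFunctionIntegralityAtTwoAutoProofs`, "INT2-AUTO": Manin's trick + the Hecke
relation at `2`): every tame fraction `x = c/(2ⁿm)` has denominator prime to `N`, so `[x]⁺_f = [0]⁺_f + k/2`
(`exists_ratPlusSymbol_eq_add_div_two`), and
`μ_{f,α,m}((a + 2ⁿℤ₂) × {b}) = α⁻ⁿ[x]⁺ − α⁻ⁿ⁻¹[2x]⁺ = α⁻ⁿk₁/2 − α⁻ⁿ⁻¹k₂/2 + α⁻ⁿ⁻¹(α − 1)[0]⁺`
with `‖(α − 1)[0]⁺‖₂ ≤ 2` (`norm_sub_one_mul_ratPlusSymbol_zero_le_two`: `(α−1)(α−2) = (a₂−3)α`, `(a₂−3)[0]⁺ ∈ ½ℤ`).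
This file runs the tree's chain again with that bound:

* §1 `norm_msdMeasureTame_two_le_two_auto`, `norm_msdMeasureTame_unitRoot_two_le_two_auto` — `‖μ_{f,α,m}‖₂ ≤ 2`, no `E[2]` input;
* §2 `norm_padicLCoeffTame_two_le_one_auto`, `exists_iwasawaToPowerSeries_eq_padicLFunctionTame_two_auto` (`L₂(f,α,χ) ∈ Λ`, `χ` even),
  `norm_padicLCoeffTame_sub_one_two_le_auto` (Matsuno L.3.2 at `2`), `exists_iwasawa_pair_map_toZMod_eq_two_auto`;
* §3 `exists_iwasawa_padicLFunctionTame_one_congr_two_auto`, **`exists_iwasawa_padicLFunctionTame_congr_two_auto`** — the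
  depletion and character halves of the cell's congruence `hcong` for EVERY `W` good ordinary at `2` (proofs = the tree's, with
  the canonical lift `exists_iwasawaToPowerSeries_eq_padicLFunction_two_auto`).

So the analytic Kida formula at `2` reaches the `E[2]`-REDUCIBLE good-ordinary curves (the habitat of the cell's door (34-PRIM)).
Normalisation caveat as in `PAdicLFunctionIntegralityAtTwoAutoProofs` (tree's `Δ`-doubled transform, periods `Ω⁺_f`).

## References

* K. Matsuno, J. Number Theory 84 (2000) 80–92, Lemmas 3.2–3.3 and proof of Thm. 3.1 (pp. 86–88). [Matsuno2000]
* B. Mazur, J. Tate, J. Teitelbaum, Invent. Math. 84 (1986), §I.4 (4.2), §I.8, §I.10–I.13. [MazurTateTeitelbaum1986Invent]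
* J. E. Cremona, *Algorithms for modular elliptic curves* (1997), §2.8. [CremonaAlgorithms1997]
* R. Greenberg, V. Vatsal, Invent. Math. 142 (2000), §1 display (8), §2 Prop. (2.4). [GreenbergVatsal2000]
-/

noncomputable section

open scoped Classical MatrixGroups ModularForm

open CongruenceSubgroup Filter Topology NumberField IsDedekindDomain WeierstrassCurve PowerSeries
  Literature.NumberTheory.EllipticCurves.ModularForms Literature.NumberTheory.EllipticCurves.GreenbergVatsal2000

namespace Literature.NumberTheory.EllipticCurves

/-! ### §1. `‖μ_{f,α,m}‖₂ ≤ 2` without an Eisenstein multiple -/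

section Measure

variable {N : ℕ} [NeZero N] {f : CuspForm (Gamma0 N) 2} {m : ℕ} [NeZero m]

/-- `‖k/2‖₂ ≤ 2` for `k ∈ ℤ`; private helper. [folklore] -/
private theorem norm_intCast_div_two_le_two (k : ℤ) : ‖((k : ℚ_[2])) / 2‖ ≤ 2 := by
  have h2 : ‖(2 : ℚ_[2])‖ = (2 : ℝ)⁻¹ := by
    have h := Padic.norm_p (p := 2)
    simpa using h
  rw [norm_div, h2, div_inv_eq_mul]
  calc ‖(k : ℚ_[2])‖ * 2 ≤ 1 * 2 := by gcongr; exact Padic.norm_int_le_one k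
    _ = 2 := one_mul _

omit [NeZero N] [NeZero m] in
/-- The denominator of `j · c/(2ⁿm)` is prime to `N` when `2 ∤ N` and `(m, N) = 1`; private helper. [folklore] -/
private theorem coprime_den_natCast_mul_tameFraction_two (hpN : ¬ 2 ∣ N) (hmN : m.Coprime N) (n : ℕ) (a : ZMod (2 ^ n))
    (b : ZMod m) (j : ℕ) : Nat.Coprime ((j : ℚ) * tameFraction 2 m n a b).den N := by
  have hcop : Nat.Coprime (2 ^ n * m) N :=
    Nat.Coprime.mul_left (Nat.Coprime.pow_left n ((Nat.Prime.coprime_iff_not_dvd Nat.prime_two).mpr hpN)) hmN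
  have h := coprime_den_of_coprime hcop ((j * tameRep 2 m n a b : ℕ) : ℤ)
  have e : (j : ℚ) * tameFraction 2 m n a b =
      (((j * tameRep 2 m n a b : ℕ) : ℤ) : ℚ) / ((2 ^ n * m : ℕ) : ℚ) := by
    unfold tameFraction; push_cast; ring
  rwa [e]

omit [NeZero m] in
/-- **`‖μ_{f,α,m}((a + 2ⁿℤ₂) × {b})‖₂ ≤ 2` for every newform of ODD level with real coefficients, `(m, N) = 1`, and the root
`α` of `X² − a₂X + 2` with `‖α⁻¹‖ ≤ 1` — NO hypothesis on `E[2]`**: the tame fractions `x = c/(2ⁿm)`, `2x` have denominators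
prime to `N`, so `[x]⁺ = [0]⁺ + k₁/2`, `[2x]⁺ = [0]⁺ + k₂/2` (`exists_ratPlusSymbol_eq_add_div_two`), and
`μ = α⁻ⁿk₁/2 − α⁻ⁿ⁻¹k₂/2 + α⁻ⁿ⁻¹(α − 1)[0]⁺`, three terms of norm `≤ 2` (`norm_sub_one_mul_ratPlusSymbol_zero_le_two`). The tame
companion of `norm_msdMeasure_two_le_two_auto`. [cite: MazurTateTeitelbaum1986Invent, §I.10 (10.1) and §I.4 (4.2)]
[cite: CremonaAlgorithms1997, §2.8] -/
theorem norm_msdMeasureTame_two_le_two_auto (hf : IsNewform0 f) (hreal : ∀ n, (cuspCoeff f n).im = 0) (h2N : ¬ 2 ∣ N)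
    {a₂ : ℤ} (ha₂ : cuspCoeff f 2 = a₂) {α : ℚ_[2]} (hα : ‖α⁻¹‖ ≤ 1) (hroot : α ^ 2 - a₂ * α + 2 = 0)
    (hmN : m.Coprime N) (n : ℕ) (a : ZMod (2 ^ n)) (b : ZMod m) :
    ‖msdMeasureTame f m α n a b‖ ≤ 2 := by
  have hε := norm_sub_one_mul_ratPlusSymbol_zero_le_two hf hreal h2N ha₂ hα hroot
  have hαi : ∀ j : ℕ, ‖α⁻¹ ^ j‖ ≤ 1 := fun j ↦ by
    rw [norm_pow]; exact pow_le_one₀ (norm_nonneg _) hα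
  have hα0 : α ≠ 0 := by rintro rfl; norm_num at hroot
  have hx₁ : Nat.Coprime (tameFraction 2 m n a b).den N := by
    have h := coprime_den_natCast_mul_tameFraction_two h2N hmN n a b 1
    rwa [Nat.cast_one, one_mul] at h
  have hx₂ : Nat.Coprime ((2 : ℚ) * tameFraction 2 m n a b).den N := by
    have h := coprime_den_natCast_mul_tameFraction_two h2N hmN n a b 2
    rwa [Nat.cast_ofNat] at h
  obtain ⟨z₁, hz₁⟩ := exists_ratPlusSymbol_eq_add_div_two f hreal hx₁
  obtain ⟨z₂, hz₂⟩ := exists_ratPlusSymbol_eq_add_div_two f hreal hx₂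
  have hcast : ((2 : ℕ) : ℚ) = (2 : ℚ) := by norm_num
  unfold msdMeasureTame
  rw [hcast, hz₁, hz₂]
  push_cast
  have hsplit : α⁻¹ ^ n * (((ratPlusSymbol f 0 : ℚ) : ℚ_[2]) + (z₁ : ℚ_[2]) / 2) -
      α⁻¹ ^ (n + 1) * (((ratPlusSymbol f 0 : ℚ) : ℚ_[2]) + (z₂ : ℚ_[2]) / 2) =
      α⁻¹ ^ n * ((z₁ : ℚ_[2]) / 2) + -(α⁻¹ ^ (n + 1) * ((z₂ : ℚ_[2]) / 2)) +
        α⁻¹ ^ (n + 1) * ((α - 1) * ((ratPlusSymbol f 0 : ℚ) : ℚ_[2])) := by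
    have hαα : α⁻¹ ^ (n + 1) * α = α⁻¹ ^ n := by
      rw [pow_succ, mul_assoc, inv_mul_cancel₀ hα0, mul_one]
    linear_combination (-((ratPlusSymbol f 0 : ℚ) : ℚ_[2])) * hαα
  rw [hsplit]
  have hA : ‖α⁻¹ ^ n * ((z₁ : ℚ_[2]) / 2)‖ ≤ 2 := by
    rw [norm_mul]
    calc _ ≤ 1 * 2 := mul_le_mul (hαi _) (norm_intCast_div_two_le_two z₁) (norm_nonneg _) zero_le_one
      _ = 2 := one_mul _
  have hB : ‖-(α⁻¹ ^ (n + 1) * ((z₂ : ℚ_[2]) / 2))‖ ≤ 2 := by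
    rw [norm_neg, norm_mul]
    calc _ ≤ 1 * 2 := mul_le_mul (hαi _) (norm_intCast_div_two_le_two z₂) (norm_nonneg _) zero_le_one
      _ = 2 := one_mul _
  have hC : ‖α⁻¹ ^ (n + 1) * ((α - 1) * ((ratPlusSymbol f 0 : ℚ) : ℚ_[2]))‖ ≤ 2 := by
    rw [norm_mul]
    calc _ ≤ 1 * 2 := mul_le_mul (hαi _) hε (norm_nonneg _) zero_le_one
      _ = 2 := one_mul _
  refine (Padic.nonarchimedean _ _).trans (max_le ?_ hC)
  exact (Padic.nonarchimedean _ _).trans (max_le hA hB)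

variable {W : WeierstrassCurve ℚ} [W.IsElliptic] [W.IsGloballyMinimal]

omit [NeZero m] in
/-- **`‖μ_{f,α,m}((a + 2ⁿℤ₂) × {b})‖₂ ≤ 2` for the newform `f` of ANY `E = W` good ordinary at `2`** (`α` the unit root,
`(m, N) = 1`) — the tree's `norm_msdMeasureTame_two_le_two` with its odd Eisenstein multiple (hence `E[2]` irreducible) REMOVED.
[cite: MazurTateTeitelbaum1986Invent, §I.10 (10.1)] -/
theorem norm_msdMeasureTame_unitRoot_two_le_two_auto (hord : IsOrdinaryAt W 2) (hf : IsNewformOf W f) (hmN : m.Coprime N)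
    (n : ℕ) (a : ZMod (2 ^ n)) (b : ZMod m) :
    ‖msdMeasureTame f m (unitRoot W 2 : ℚ_[2]) n a b‖ ≤ 2 := by
  obtain ⟨hαeq, hαu, -⟩ := unitRoot_coe_spec (W := W) hord
  have hα : ‖(unitRoot W 2 : ℚ_[2])⁻¹‖ ≤ 1 := by rw [norm_inv, hαu, inv_one]
  exact norm_msdMeasureTame_two_le_two_auto hf.1 (cuspCoeff_im_eq_zero_of_coeffField_eq_bot hf.coeffField_eq_bot)
    (not_dvd_level_of_isNewformOf hf hord.1) (cuspCoeff_eq_frobeniusTrace_of_isNewformOf_holds hf hord.1) hα hαeq hmN n a b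

end Measure

/-! ### §2. Integrality of `L₂(f,α,χ)` and Matsuno's Lemma 3.2 at `2`, for every `E` good ordinary at `2` -/

section Integrality

variable {N : ℕ} [NeZero N] {f : CuspForm (Gamma0 N) 2} {m : ℕ} [NeZero m]
  {W : WeierstrassCurve ℚ} [W.IsElliptic] [W.IsGloballyMinimal]

omit [NeZero m] in
/-- The trivial character mod `m` is even; private helper. [folklore] -/
private theorem even_one_dirichletCharacter' {R : Type*} [CommRing R] : (1 : DirichletCharacter R m).Even := by
  show (1 : DirichletCharacter R m) (-1) = 1
  rw [MulChar.one_apply (isUnit_one.neg)]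

/-- **`‖[T^k] L₂(f, α, χ, T)‖₂ ≤ 1` for `χ` EVEN and EVERY `E` good ordinary at `2`** (`m` prime to `2N`): the tree's
`norm_padicLCoeffTame_two_le_one` with the `E[2]`-irreducibility removed (`‖μ‖ ≤ 2` from §1, the doubling
`norm_padicLRiemannSumTame_two_le`, convergence `tendsto_padicLRiemannSumTame_unitRoot_two`).
[cite: MazurTateTeitelbaum1986Invent, §I.10–§I.13 (pp. 12–19)] -/
theorem norm_padicLCoeffTame_two_le_one_auto (hord : IsOrdinaryAt W 2) (hf : IsNewformOf W f) (hm2 : m.Coprime 2)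
    (hmN : m.Coprime N) (χ : DirichletCharacter ℚ_[2] m) (hχ : χ.Even) (k : ℕ) :
    ‖padicLCoeffTame f m (unitRoot W 2 : ℚ_[2]) χ k‖ ≤ 1 := by
  have hμ := norm_msdMeasureTame_unitRoot_two_le_two_auto (m := m) hord hf hmN
  have h2 : ‖(2 : ℚ_[2])‖ = (2 : ℝ)⁻¹ := by
    have h := Padic.norm_p (p := 2)
    simpa using h
  have hRS : ∀ n, ‖padicLRiemannSumTame f m (unitRoot W 2 : ℚ_[2]) χ k n‖ ≤ 1 := by
    intro n
    have h := norm_padicLRiemannSumTame_two_le f hm2 _ χ hχ zero_le_two hμ k n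
    rw [h2] at h
    linarith
  exact le_of_tendsto (tendsto_padicLRiemannSumTame_unitRoot_two hord hf hm2 χ k).norm (Eventually.of_forall hRS)

/-- **`L₂(f, α, χ, T) ∈ Λ = ℤ₂⟦T⟧` for `χ` even and EVERY `E` good ordinary at `2`** (`m` prime to `2N`).
[cite: MazurTateTeitelbaum1986Invent, §I.12 (p. 17)] -/
theorem exists_iwasawaToPowerSeries_eq_padicLFunctionTame_two_auto (hord : IsOrdinaryAt W 2) (hf : IsNewformOf W f)
    (hm2 : m.Coprime 2) (hmN : m.Coprime N) (χ : DirichletCharacter ℚ_[2] m) (hχ : χ.Even) :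
    ∃ G : IwasawaAlgebra 2, iwasawaToPowerSeries 2 G = padicLFunctionTame f m (unitRoot W 2 : ℚ_[2]) χ :=
  (exists_iwasawaToPowerSeries_eq_iff_norm_coeff_le_one _).mpr fun k ↦ by
    rw [coeff_padicLFunctionTame]
    exact norm_padicLCoeffTame_two_le_one_auto hord hf hm2 hmN χ hχ k

/-- **Matsuno 2000, Lemma 3.2 at `p = 2` for EVERY `E` good ordinary at `2`** (tree normalisation): for `χ` even with
`χ² = 1` mod `m`, `(m, 2N) = 1`: `‖[T^k] L₂(f,α,χ) − [T^k] L₂(f,α,𝟙_m)‖₂ ≤ ‖2‖₂` — the tree's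
`norm_padicLCoeffTame_sub_one_two_le` with the `E[2]`-irreducibility removed. [cite: Matsuno2000, Lemma 3.2 (p. 87)] -/
theorem norm_padicLCoeffTame_sub_one_two_le_auto (hord : IsOrdinaryAt W 2) (hf : IsNewformOf W f) (hm2 : m.Coprime 2)
    (hmN : m.Coprime N) (χ : DirichletCharacter ℚ_[2] m) (hχ : χ.Even) (hsq : χ ^ 2 = 1) (k : ℕ) :
    ‖padicLCoeffTame f m (unitRoot W 2 : ℚ_[2]) χ k -
        padicLCoeffTame f m (unitRoot W 2 : ℚ_[2]) (1 : DirichletCharacter ℚ_[2] m) k‖ ≤ ‖(2 : ℚ_[2])‖ := by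
  have hμ := norm_msdMeasureTame_unitRoot_two_le_two_auto (m := m) hord hf hmN
  have h2 : ‖(2 : ℚ_[2])‖ = (2 : ℝ)⁻¹ := by
    have h := Padic.norm_p (p := 2)
    simpa using h
  have hRS : ∀ n, ‖padicLRiemannSumTame f m (unitRoot W 2 : ℚ_[2]) χ k n -
      padicLRiemannSumTame f m (unitRoot W 2 : ℚ_[2]) (1 : DirichletCharacter ℚ_[2] m) k n‖ ≤ ‖(2 : ℚ_[2])‖ := by
    intro n
    have h := norm_padicLRiemannSumTame_sub_two_le f hm2 _ χ 1 hχ even_one_dirichletCharacter' (norm_nonneg _)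
      (norm_sub_one_apply_le_of_sq_eq_one χ hsq) zero_le_two hμ k n
    rw [h2] at h ⊢
    linarith
  exact le_of_tendsto ((tendsto_padicLRiemannSumTame_unitRoot_two hord hf hm2 χ k).sub
    (tendsto_padicLRiemannSumTame_unitRoot_two hord hf hm2 1 k)).norm (Eventually.of_forall hRS)

/-- **`L₂(f,α,χ) ≡ L₂(f,α,𝟙_m) (mod 2Λ)` as reductions of integral lifts, for EVERY `E` good ordinary at `2`** — the tree's
`exists_iwasawa_pair_map_toZMod_eq_two` with the `E[2]`-irreducibility removed. [cite: Matsuno2000, Lemma 3.2 (p. 87)]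
[cite: MazurTateTeitelbaum1986Invent, §I.12 (p. 17)] -/
theorem exists_iwasawa_pair_map_toZMod_eq_two_auto (hord : IsOrdinaryAt W 2) (hf : IsNewformOf W f) (hm2 : m.Coprime 2)
    (hmN : m.Coprime N) (χ : DirichletCharacter ℚ_[2] m) (hχ : χ.Even) (hsq : χ ^ 2 = 1) :
    ∃ G G₁ : IwasawaAlgebra 2,
      iwasawaToPowerSeries 2 G = padicLFunctionTame f m (unitRoot W 2 : ℚ_[2]) χ ∧
      iwasawaToPowerSeries 2 G₁ = padicLFunctionTame f m (unitRoot W 2 : ℚ_[2]) (1 : DirichletCharacter ℚ_[2] m) ∧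
      PowerSeries.map (PadicInt.toZMod (p := 2)) G = PowerSeries.map (PadicInt.toZMod (p := 2)) G₁ := by
  refine exists_iwasawa_pair_map_toZMod_eq _ _ (fun k ↦ ?_) (fun k ↦ ?_) (fun k ↦ ?_)
  · rw [coeff_padicLFunctionTame]
    exact norm_padicLCoeffTame_two_le_one_auto hord hf hm2 hmN χ hχ k
  · rw [coeff_padicLFunctionTame]
    exact norm_padicLCoeffTame_two_le_one_auto hord hf hm2 hmN 1 even_one_dirichletCharacter' k
  · rw [coeff_padicLFunctionTame, coeff_padicLFunctionTame]
    have h2 : ‖(2 : ℚ_[2])‖ = (2 : ℝ)⁻¹ := by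
      have h := Padic.norm_p (p := 2)
      simpa using h
    have h := norm_padicLCoeffTame_sub_one_two_le_auto hord hf hm2 hmN χ hχ hsq k
    rw [h2] at h
    linarith

end Integrality

/-! ### §3. The depletion and character halves of the congruence, for every `E` good ordinary at `2` -/

section Depletion

variable {N : ℕ} [NeZero N] {f : CuspForm (Gamma0 N) 2}
  {W : WeierstrassCurve ℚ} [W.IsElliptic] [W.IsGloballyMinimal]

/-- Distinct finite places of `ℚ` lie over distinct primes; private helper. [folklore] -/
private theorem natGenerator_injective_rat'' :
    Function.Injective (Rat.HeightOneSpectrum.natGenerator (R := 𝓞 ℚ)) := fun _ _ h ↦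
  (Rat.HeightOneSpectrum.primesEquiv (R := 𝓞 ℚ)).injective (Subtype.ext h)

/-- `−(1+T)^{c}` is a unit of `Λ`; private helper. [folklore] -/
private theorem isUnit_neg_binomialSeries' {p : ℕ} [Fact p.Prime] (c : ℤ_[p]) :
    IsUnit (-PowerSeries.binomialSeries ℤ_[p] c) := by
  refine (isUnit_iff_exists_inv.mpr ⟨PowerSeries.binomialSeries ℤ_[p] (-c), ?_⟩).neg
  rw [← PowerSeries.binomialSeries_add, add_neg_cancel, PowerSeries.binomialSeries_zero]

/-- **The `m`-depleted `2`-adic `L`-function vs `L₂(E)·∏𝒫_ℓ` modulo `2`, for EVERY `E` good ordinary at `2`** — the tree's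
`exists_iwasawa_padicLFunctionTame_one_congr_two` (Matsuno's Lemma 3.3 iterated; `𝒫_ℓ ≡ −(1+T)^{f_ℓ}h_ℓ (mod 2)`) with the
`E[2]`-irreducibility removed: the canonical lift `L_W` of `L₂(f,α)` exists for every such `E`
(`exists_iwasawaToPowerSeries_eq_padicLFunction_two_auto`); the rest of the proof is the tree's verbatim.
[cite: Matsuno2000, Lemma 3.3 and proof of Theorem 3.1 (pp. 87–88)] [cite: GreenbergVatsal2000, §1 p. 9 (display (8)) and §2 Prop. (2.4)] -/
theorem exists_iwasawa_padicLFunctionTame_one_congr_two_auto (hord : IsOrdinaryAt W 2) (hf : IsNewformOf W f)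
    (S₀ : Finset (HeightOneSpectrum (𝓞 ℚ)))
    (hS2 : ∀ v ∈ S₀, Rat.HeightOneSpectrum.natGenerator v ≠ 2) (hgood : ∀ v ∈ S₀, W.HasGoodReductionAt v)
    {m : ℕ} [NeZero m] (hm : m = ∏ v ∈ S₀, Rat.HeightOneSpectrum.natGenerator v) :
    ∃ (LW G₁ : IwasawaAlgebra 2) (u : (IwasawaAlgebra 2)ˣ),
      iwasawaToPowerSeries 2 LW = padicLFunction f (unitRoot W 2 : ℚ_[2]) ∧
      iwasawaToPowerSeries 2 G₁ = padicLFunctionTame f m (unitRoot W 2 : ℚ_[2]) 1 ∧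
      PowerSeries.map (PadicInt.toZMod (p := 2)) G₁ =
        PowerSeries.map (PadicInt.toZMod (p := 2)) ((u : IwasawaAlgebra 2) * LW * eulerFactorProduct W 2 S₀) := by
  obtain ⟨LW, hLW⟩ := exists_iwasawaToPowerSeries_eq_padicLFunction_two_auto hord hf
  obtain ⟨hαeq, hαu, -⟩ := unitRoot_coe_spec (W := W) hord
  have hpN : ¬ 2 ∣ N := not_dvd_level_of_isNewformOf hf hord.1
  have hprime : ∀ v : HeightOneSpectrum (𝓞 ℚ), (Rat.HeightOneSpectrum.natGenerator v).Prime := fun v ↦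
    (Rat.HeightOneSpectrum.primesEquiv v).2
  have hcop : ∀ v ∈ S₀, (Rat.HeightOneSpectrum.natGenerator v).Coprime 2 := fun v hv ↦
    (Nat.coprime_primes (hprime v) Nat.prime_two).mpr (hS2 v hv)
  have hgoodp : ∀ v ∈ S₀, (haveI : Fact (Rat.HeightOneSpectrum.natGenerator v).Prime := ⟨hprime v⟩;
      W.HasGoodReductionAtPrime (Rat.HeightOneSpectrum.natGenerator v)) := fun v hv ↦
    (hasGoodReductionAtPrime_iff_hasGoodReductionAt_ringOfIntegers v W).mpr (hgood v hv)
  -- Teichmüller data `ℓ ≡ ω(ℓ) γ^{f_ℓ}` at every finite level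
  set teich : ℕ → rootsOfUnity (torsionOrder 2) ℤ_[2] := fun ℓ ↦
    if h : ℓ.Coprime 2 then Classical.choose (exists_teichmuller_frobeniusExponent 2 h) else 1 with hteich
  have hc : ∀ ℓ ∈ S₀.image Rat.HeightOneSpectrum.natGenerator, ∀ n : ℕ,
      PadicInt.toZModPow (n + cyclotomicExponent 2) ((teich ℓ : ℤ_[2]ˣ) : ℤ_[2]) *
        (cyclotomicGenerator 2 : ZMod (2 ^ (n + cyclotomicExponent 2))) ^
          (PadicInt.toZModPow n ((fun ℓ : ℕ ↦ frobeniusExponent 2 (ℓ : ℤ_[2])) ℓ)).val =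
          (ℓ : ZMod (2 ^ (n + cyclotomicExponent 2))) := by
    intro ℓ hℓ n
    obtain ⟨v, hv, rfl⟩ := Finset.mem_image.mp hℓ
    have h := hcop v hv
    simp only [hteich, dif_pos h]
    exact Classical.choose_spec (exists_teichmuller_frobeniusExponent 2 h) n
  have hS : ∀ ℓ ∈ S₀.image Rat.HeightOneSpectrum.natGenerator, ℓ.Prime ∧ ¬ ℓ ∣ N ∧ ℓ.Coprime 2 := by
    intro ℓ hℓ
    obtain ⟨v, hv, rfl⟩ := Finset.mem_image.mp hℓ
    haveI : Fact (Rat.HeightOneSpectrum.natGenerator v).Prime := ⟨hprime v⟩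
    exact ⟨hprime v, not_dvd_level_of_isNewformOf hf (hgoodp v hv), hcop v hv⟩
  have ha : ∀ ℓ ∈ S₀.image Rat.HeightOneSpectrum.natGenerator, cuspCoeff f ℓ = ((W.frobeniusTrace ℓ : ℤ) : ℂ) := by
    intro ℓ hℓ
    obtain ⟨v, hv, rfl⟩ := Finset.mem_image.mp hℓ
    haveI : Fact (Rat.HeightOneSpectrum.natGenerator v).Prime := ⟨hprime v⟩
    exact cuspCoeff_eq_frobeniusTrace_of_isNewformOf_holds hf (hgoodp v hv)
  have hinj : ∀ v ∈ S₀, ∀ w ∈ S₀,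
      Rat.HeightOneSpectrum.natGenerator v = Rat.HeightOneSpectrum.natGenerator w → v = w :=
    fun v _ w _ h ↦ natGenerator_injective_rat'' h
  have hm' : m = ∏ ℓ ∈ S₀.image Rat.HeightOneSpectrum.natGenerator, ℓ := by
    rw [hm, Finset.prod_image hinj]
  have hG₁ := iwasawaToPowerSeries_prod_tameEulerFactor_mul hf.1 hf.coeffField_eq_bot hpN
    (cuspCoeff_eq_frobeniusTrace_of_isNewformOf_holds hf hord.1) hαeq hαu (a := W.frobeniusTrace)
    (teich := teich) (c := fun ℓ : ℕ ↦ frobeniusExponent 2 (ℓ : ℤ_[2])) hS ha hc hm' hLW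
  -- the unit `u = ∏ (−(1+T)^{−f_ℓ})`
  set uv : HeightOneSpectrum (𝓞 ℚ) → (IwasawaAlgebra 2)ˣ := fun v ↦
    (isUnit_neg_binomialSeries' (-frobeniusExponent 2 (Rat.HeightOneSpectrum.natGenerator v : ℤ_[2]))).unit with huv
  have huv_val : ∀ v, ((uv v : (IwasawaAlgebra 2)ˣ) : IwasawaAlgebra 2) =
      -PowerSeries.binomialSeries ℤ_[2] (-frobeniusExponent 2 (Rat.HeightOneSpectrum.natGenerator v : ℤ_[2])) :=
    fun v ↦ IsUnit.unit_spec _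
  -- per place: `u_v 𝒫_v ≡ h_ℓ (mod 2)`
  have key : ∀ v ∈ S₀, PowerSeries.map (PadicInt.toZMod (p := 2))
      (C ((W.frobeniusTrace (Rat.HeightOneSpectrum.natGenerator v) : ℤ) : ℤ_[2]) -
        PowerSeries.binomialSeries ℤ_[2] (-frobeniusExponent 2 (Rat.HeightOneSpectrum.natGenerator v : ℤ_[2])) -
        PowerSeries.binomialSeries ℤ_[2] (frobeniusExponent 2 (Rat.HeightOneSpectrum.natGenerator v : ℤ_[2]))) =
      PowerSeries.map (PadicInt.toZMod (p := 2)) ((uv v : IwasawaAlgebra 2) * eulerFactorElement W 2 v) := by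
    intro v hv
    have hE := map_toZMod_eulerFactorElement_two_eq W v (hgood v hv) (hcop v hv)
    rw [frobeniusTraceAt_eq_frobeniusTrace] at hE
    rw [map_mul, hE, ← map_mul, huv_val, frobeniusSeries_eq, ← mul_assoc, neg_mul_neg,
      ← PowerSeries.binomialSeries_add, neg_add_cancel, PowerSeries.binomialSeries_zero, one_mul]
    rfl
  refine ⟨LW, _, ∏ v ∈ S₀, uv v, hLW, hG₁, ?_⟩
  rw [Finset.prod_image hinj, map_mul, map_prod, Finset.prod_congr rfl key, Units.coe_prod, eulerFactorProduct_eq,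
    map_mul, map_mul, map_prod, map_prod]
  simp only [map_mul]
  rw [Finset.prod_mul_distrib]
  ring

/-- **The `χ`-twisted tame `2`-adic `L`-function vs `L₂(E)·∏𝒫_ℓ` modulo `2`, for EVERY `E` good ordinary at `2`** —
the tree's `exists_iwasawa_padicLFunctionTame_congr_two` with the `E[2]`-irreducibility removed: for `S₀` a finite set of odd
places of good reduction, `m = ∏_{v∈S₀} ℓ_v` and `χ` an EVEN QUADRATIC `ℚ₂`-valued character mod `m`, there are `L_W, G ∈ ℤ₂⟦T⟧`,
`u ∈ ℤ₂⟦T⟧ˣ` with `ι L_W = L₂(f,α)`, `ι G = L₂(f,α,χ)` and `G ≡ u·L_W·∏_{v∈S₀}𝒫_v (mod 2)` (§2 + the depletion half, glued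
through `iwasawaToPowerSeries_injective`). [cite: Matsuno2000, Lemmas 3.2–3.3 and proof of Theorem 3.1 (pp. 87–88)] -/
theorem exists_iwasawa_padicLFunctionTame_congr_two_auto (hord : IsOrdinaryAt W 2) (hf : IsNewformOf W f)
    (S₀ : Finset (HeightOneSpectrum (𝓞 ℚ)))
    (hS2 : ∀ v ∈ S₀, Rat.HeightOneSpectrum.natGenerator v ≠ 2) (hgood : ∀ v ∈ S₀, W.HasGoodReductionAt v)
    {m : ℕ} [NeZero m] (hm : m = ∏ v ∈ S₀, Rat.HeightOneSpectrum.natGenerator v)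
    (χ : DirichletCharacter ℚ_[2] m) (hχ : χ.Even) (hsq : χ ^ 2 = 1) :
    ∃ (LW G : IwasawaAlgebra 2) (u : (IwasawaAlgebra 2)ˣ),
      iwasawaToPowerSeries 2 LW = padicLFunction f (unitRoot W 2 : ℚ_[2]) ∧
      iwasawaToPowerSeries 2 G = padicLFunctionTame f m (unitRoot W 2 : ℚ_[2]) χ ∧
      PowerSeries.map (PadicInt.toZMod (p := 2)) G =
        PowerSeries.map (PadicInt.toZMod (p := 2)) ((u : IwasawaAlgebra 2) * LW * eulerFactorProduct W 2 S₀) := by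
  have hprime : ∀ v : HeightOneSpectrum (𝓞 ℚ), (Rat.HeightOneSpectrum.natGenerator v).Prime := fun v ↦
    (Rat.HeightOneSpectrum.primesEquiv v).2
  have hm2 : m.Coprime 2 := by
    rw [hm]
    exact Nat.Coprime.prod_left fun v hv ↦ (Nat.coprime_primes (hprime v) Nat.prime_two).mpr (hS2 v hv)
  have hmN : m.Coprime N := by
    rw [hm]
    refine Nat.Coprime.prod_left fun v hv ↦ ?_
    haveI : Fact (Rat.HeightOneSpectrum.natGenerator v).Prime := ⟨hprime v⟩
    have hgp : W.HasGoodReductionAtPrime (Rat.HeightOneSpectrum.natGenerator v) :=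
      (hasGoodReductionAtPrime_iff_hasGoodReductionAt_ringOfIntegers v W).mpr (hgood v hv)
    exact (Nat.Prime.coprime_iff_not_dvd (hprime v)).mpr (not_dvd_level_of_isNewformOf hf hgp)
  obtain ⟨G, G₁, hG, hG₁, hGG₁⟩ := exists_iwasawa_pair_map_toZMod_eq_two_auto hord hf hm2 hmN χ hχ hsq
  obtain ⟨LW, G₁', u, hLW, hG₁', hcongr⟩ := exists_iwasawa_padicLFunctionTame_one_congr_two_auto hord hf S₀ hS2 hgood hm
  have hEq : G₁ = G₁' := iwasawaToPowerSeries_injective 2 (hG₁.trans hG₁'.symm)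
  exact ⟨LW, G, u, hLW, hG, by rw [hGG₁, hEq, hcongr]⟩

end Depletion

end Literature.NumberTheory.EllipticCurves

end
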